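import Mathlib
import Summits.NavierStokesRegularity.NavierStokesRegularity.Theorems.EulerZoomLiouvillePowerGaugeEulerLiouvilleExtinctIdentity
import Summits.NavierStokesRegularity.NavierStokesRegularity.Theorems.EulerZoomLiouvillePowerGaugeEulerLiouvilleLionsGate
import Summits.NavierStokesRegularity.NavierStokesRegularity.Theorems.EulerZoomLiouvillePowerGaugeEulerLiouvilleWindowFluxBoundsSplit
import HarnessLib

/-!
# «NO L⁴-INTEGRABLE EULER COLLAPSE INTO REST»: the Lions gate ∘ the extinct-trace stratum, a weak-class stratum of the crux
# `EulerZoomLiouville.PowerGaugeEulerLiouville` (stmt-NavierStokesRegularity-19832; lines `lions_gate` O1 + `extinct_trace` X2 + the lead's (G2);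
# width seat ns-ezl-w1 g4)

Route №10 `EulerZoomLiouville` (NavierStokesRegularity).  Three tree theorems compose BY NAME into a member-level stratum with NO conservativity
hypothesis: the LIONS GATE (`LionsGate.isEnergyConservative_of_memL4Loc`, p648026: `L⁴_loc` members are conservative), the lead's final-window flux
bound from the gauges (`exists_oneBall_window_le_split`, (G2)), and the extinct-trace stratum (`ExtinctTrace.extinctIdentity`, p649850: conservative
∧ energy-extinct ⇒ trivial for `2/9 < ρ ≤ 1/2`):

* `ae_eq_zero_of_memL4Loc_of_energyExtinct` — binder shape `InClass ρ u p H c → MemL4Loc u → IsEnergyExtinct u → VanishesAE u` for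
  `2/9 < ρ ≤ 1/2` (bodies verbatim): a member with `u ∈ L⁴((−a², 0) × B_a)` for every `a` whose energy on every fixed ball tends to `0`
  as `τ → 0⁻` is trivial.

HONEST LABEL: thin weak-class stratum for the non-self-similar rest (self-similar candidates are energy-persistent).  WHAT THIS IS NOT:
not NS, not E — `--supports` stmt-19832; 19832 OPEN; NS regularity NOT proved. [cite: Seregin2025TypeIIScenario, §2]
-/

noncomputable section

-- flat `Theorems/<Route><Decl>…` files of one crux share the namespace of the crux (tree convention)
set_option linter.dupNamespace false

open MeasureTheory Set Filter Topology Metric Function InnerProductSpace TopologicalSpace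
open scoped RealInnerProductSpace NNReal ENNReal

namespace Summit.NavierStokesRegularity.NavierStokesRegularity.Theorems.PowerGaugeEulerLiouville.ExtinctTrace

open Literature.Analysis Literature.Analysis.FluidPDE

/-- **«NO L⁴-INTEGRABLE EULER COLLAPSE INTO REST»** (`2/9 < ρ ≤ 1/2`): a member of Seregin's power-gauged ancient Euler class with
`u ∈ L⁴((−a², 0) × B_a)` for every `a > 0` and `∫_{B_a}|u(τ)|² → 0` as `τ → 0⁻` for every `a > 0` vanishes a.e. — the Lions gate makes it
conservative, the gauges bound the final-window flux, and the extinct-trace stratum closes. [cite: Seregin2025TypeIIScenario, §2] -/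
theorem ae_eq_zero_of_memL4Loc_of_energyExtinct :
    ∀ ρ : ℝ, 2 / 9 < ρ → ρ ≤ 1 / 2 →
      ∀ (u : ℝ → EuclideanSpace ℝ (Fin 3) → EuclideanSpace ℝ (Fin 3)) (p : ℝ → EuclideanSpace ℝ (Fin 3) → ℝ)
        (H : ℝ → EuclideanSpace ℝ (Fin 3) → EuclideanSpace ℝ (Fin 3) →L[ℝ] EuclideanSpace ℝ (Fin 3)) (c : ℝ≥0),
      (IsSuitableWeakSolutionOn (slab (EuclideanSpace ℝ (Fin 3)) (Set.Iio 0) isOpen_Iio) 0 0 u p ∧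
        HasWeakSpatialGradientOn (slab (EuclideanSpace ℝ (Fin 3)) (Set.Iio 0) isOpen_Iio) u H ∧
        (∀ a : ℝ, 0 < a →
          ENNReal.ofReal (a ^ (2 * ρ)) * cknA a (0 : ℝ × EuclideanSpace ℝ (Fin 3)) u +
              ENNReal.ofReal (a ^ ρ) * cknE a (0 : ℝ × EuclideanSpace ℝ (Fin 3)) H +
            ENNReal.ofReal (a ^ (2 * ρ)) * cknD a (0 : ℝ × EuclideanSpace ℝ (Fin 3)) p ≤ (c : ℝ≥0∞))) →
      (∀ a : ℝ, 0 < a →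
        ∫⁻ z in Set.Ioo (-(a ^ 2)) 0 ×ˢ Metric.ball (0 : EuclideanSpace ℝ (Fin 3)) a, ‖u z.1 z.2‖ₑ ^ (4 : ℕ) < ⊤) →
      (∀ a : ℝ, 0 < a →
        Tendsto (fun τ : ℝ => ∫⁻ x in Metric.ball (0 : EuclideanSpace ℝ (Fin 3)) a, ‖u τ x‖ₑ ^ 2)
          (𝓝[<] (0 : ℝ)) (𝓝 0)) →
      Function.uncurry u =ᵐ[volume.restrict (Set.Iio (0 : ℝ) ×ˢ (Set.univ : Set (EuclideanSpace ℝ (Fin 3))))] 0 := by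
  intro ρ hρ hρh u p H c hcls hL4 hext
  have hρ0 : 0 ≤ ρ := by linarith
  refine extinctIdentity ρ hρ hρh u p H c hcls
    (fun s hs => exists_oneBall_window_le_split hρ0 hcls.1 hcls.2.1 hcls.2.2 hs le_rfl)
    ⟨LionsGate.isEnergyConservative_of_memL4Loc ρ u p H c hcls hL4, hext⟩

end Summit.NavierStokesRegularity.NavierStokesRegularity.Theorems.PowerGaugeEulerLiouville.ExtinctTrace

end
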